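import Summits.QuantumFields.YangMills.Theorems.AllWindowsColdBoxBulkMidCollarGeometry
import Summits.QuantumFields.YangMills.Theorems.WeakCouplingRatesDirichletHodge

/-!
# LINE-18 v5 (crux `AllWindowsColdBox.BulkMidWindowSU2`, ⟨stmt-QuantumFields-24006⟩), toward stub K3′ `stub_harmonicMaxPrincipleFlux`:
# an admissible competitor with uniformly small circulations under the typed hypothesis of K3′

Under the hypothesis of the registered obligation K3′ `DirHarmonicMaxPrincipleFlux` — `(sCirc (glue ϑ 0) q)² ≤ B` for every plaquette key `q`
whose four edges lie outside `dirFreeEdges H` — there are free Dirichlet values `s` whose glued field `glue ϑ s` has EVERY circulation bounded by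
`12 √B` (`exists_dirFree_sCirc_glue_abs_le`).  Construction: gauge the boundary of the cold box `Λ = {0,…,2H}⁴` by the vertex function
`ν = −σ` on `∂Λ` (`σ(v)` = the datum on one normal link at `v`: an outward one if `v` has a coordinate `2H`, else an inward one), absorb the
temporal-forest values of the datum and `dν|_Λ` into the free variables by the tree's forest gauge ✓`exists_dirFree_curl_eq`; the resulting
edge function is `dν + W` with `W` supported on the shell and normal links, where `|W| ≤ 3√B` by the collar relations of
`…BulkMidCollarGeometry` (shell values `≤ √B`, normal links at one vertex agree up to `3√B`), and `sCirc (dν) = 0`.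

No definition, standard axioms.  HONEST LABEL: helper toward ONE registered stub of a critic-passed line on the R2ξ″ RECORD-rung crux 24006;
no stub, crux, rung or summit is proved here; the Yang–Mills mass gap is NOT proved by this file.
-/

set_option autoImplicit false

noncomputable section

open Finset
open Literature.Probability.LatticeModels (Site halfOpenBox mem_halfOpenBox)
open Literature.MathematicalPhysics.QuantumFieldTheory
open Literature.MathematicalPhysics.QuantumFieldTheory.LatticeMaxwell
open Literature.MathematicalPhysics.QuantumFieldTheory.AxialGauge
open Summit.QuantumFields.YangMills.Theorems.WeakCouplingRates

namespace Summit.QuantumFields.YangMills.Theorems.AllWindowsColdBoxBulkMidLine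

variable {H : ℕ}

/-- The circulation of an exact edge function `e ↦ ν(e⁺) − ν(e⁻)` vanishes. -/
theorem sCirc_coboundary_eq_zero (ν : Site 4 → ℝ) (p : Plaq 4) :
    sCirc (fun e : Literature.MathematicalPhysics.QuantumLattice.ZdEdge 4 => ν (e.1 + Pi.single e.2 1) - ν e.1) p = 0 := by
  simp only [sCirc]
  rw [add_right_comm p.1 (Pi.single p.2.2 (1 : ℤ)) (Pi.single p.2.1 (1 : ℤ))]
  ring

/-- Temporal-forest edges are cold-box edges. -/
theorem mem_coldBoxEdges_of_forest {x : Site 4} (hx : ∀ k : Fin 4, 1 ≤ x k ∧ x k + 1 ≤ 2 * (H : ℤ)) :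
    (x, (0 : Fin 4)) ∈ boxEdges 4 (2 * H + 1) :=
  mem_coldBoxEdges_iff.2 ⟨fun k => by have := hx k; omega, by have := hx 0; omega⟩

/-- **An admissible competitor with small circulations.**  Under the typed hypothesis of K3′ (and `H ≥ 1`) there are free Dirichlet values
`s` with `|sCirc (glue ϑ s) p| ≤ 12 √B` for EVERY plaquette key `p`. -/
theorem exists_dirFree_sCirc_glue_abs_le (hH : 1 ≤ H) {ϑ : Literature.MathematicalPhysics.QuantumLattice.ZdEdge 4 → ℝ} {B : ℝ}
    (hB : ∀ q : Plaq 4, (q.1, q.2.1) ∉ dirFreeEdges H → (q.1 + Pi.single q.2.1 1, q.2.2) ∉ dirFreeEdges H →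
      (q.1 + Pi.single q.2.2 1, q.2.1) ∉ dirFreeEdges H → (q.1, q.2.2) ∉ dirFreeEdges H →
      (sCirc (LatticeMaxwell.glue (pin := fun e => e ∉ dirFreeEdges H) dirCorner (2 * H + 3) ϑ 0) q) ^ 2 ≤ B) :
    ∃ s : DirFree H → ℝ, ∀ p : Plaq 4,
      |sCirc (LatticeMaxwell.glue (pin := fun e => e ∉ dirFreeEdges H) dirCorner (2 * H + 3) ϑ s) p| ≤ 12 * Real.sqrt B := by
  classical
  have hH' : (1 : ℤ) ≤ H := by exact_mod_cast hH
  have hsq : 0 ≤ Real.sqrt B := Real.sqrt_nonneg B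
  -- the boundary gauge value `σ` and the vertex function `ν = −σ` on `∂Λ`
  set σ : Site 4 → ℝ := fun v =>
    if h : ∃ j : Fin 4, v j = 2 * (H : ℤ) then ϑ (v, h.choose)
    else if h' : ∃ j : Fin 4, v j = 0 then -ϑ (v - Pi.single h'.choose (1 : ℤ), h'.choose) else 0 with hσdef
  set ν : Site 4 → ℝ := fun v =>
    if (∀ k, 0 ≤ v k ∧ v k ≤ 2 * (H : ℤ)) ∧ (∃ k, v k = 0 ∨ v k = 2 * (H : ℤ)) then -σ v else 0 with hνdef
  set dν : Literature.MathematicalPhysics.QuantumLattice.ZdEdge 4 → ℝ := fun e => ν (e.1 + Pi.single e.2 1) - ν e.1 with hdνdef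
  have hσtop : ∀ v (h : ∃ j : Fin 4, v j = 2 * (H : ℤ)), σ v = ϑ (v, h.choose) := fun v h => by
    simp only [hσdef, dif_pos h]
  have hσbot : ∀ v (h : ¬ ∃ j : Fin 4, v j = 2 * (H : ℤ)) (h' : ∃ j : Fin 4, v j = 0),
      σ v = -ϑ (v - Pi.single h'.choose (1 : ℤ), h'.choose) := fun v h h' => by
    simp only [hσdef, dif_neg h, dif_pos h']
  have hν0 : ∀ v : Site 4, ¬ (∀ k, 0 ≤ v k ∧ v k ≤ 2 * (H : ℤ)) → ν v = 0 := fun v hv => by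
    simp only [hνdef]; rw [if_neg]; exact fun h => hv h.1
  have hνb : ∀ v : Site 4, (∀ k, 0 ≤ v k ∧ v k ≤ 2 * (H : ℤ)) → (∃ k, v k = 0 ∨ v k = 2 * (H : ℤ)) → ν v = -σ v :=
    fun v hv hk => by simp only [hνdef]; rw [if_pos ⟨hv, hk⟩]
  -- the edge function to be absorbed into the free variables: `dν` on the cold box minus the datum on the forest
  set φ : Site 4 → Fin 4 → ℝ := fun x i =>
    (if (x, i) ∈ boxEdges 4 (2 * H + 1) then dν (x, i) else 0) -
      (if (i = 0 ∧ ∀ k : Fin 4, 1 ≤ x k ∧ x k + 1 ≤ 2 * (H : ℤ)) then ϑ (x, i) else 0) with hφdef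
  have hφ : ∀ x i, φ x i ≠ 0 → (x, i) ∈ boxEdges 4 (2 * H + 1) := by
    intro x i h
    by_contra hE
    apply h
    simp only [hφdef, if_neg hE]
    rw [if_neg, sub_zero]
    rintro ⟨rfl, hx⟩
    exact hE (mem_coldBoxEdges_of_forest hx)
  obtain ⟨s, hs⟩ := exists_dirFree_curl_eq H φ hφ
  refine ⟨s, fun p => ?_⟩
  -- the glued field is `dν + W`
  set G : Literature.MathematicalPhysics.QuantumLattice.ZdEdge 4 → ℝ :=
    LatticeMaxwell.glue (pin := fun e => e ∉ dirFreeEdges H) dirCorner (2 * H + 3) ϑ 0 with hGdef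
  set W : Literature.MathematicalPhysics.QuantumLattice.ZdEdge 4 → ℝ := fun e => G e + φ e.1 e.2 - dν e with hWdef
  have hc : sCirc (LatticeMaxwell.glue (pin := fun e => e ∉ dirFreeEdges H) dirCorner (2 * H + 3) ϑ s) p = sCirc W p := by
    have h0 := sCirc_coboundary_eq_zero ν p
    rw [sCirc_glue, hs p, bterm]
    simp only [hWdef, hGdef, hdνdef, sCirc, LatticeForm.d₁, LatticeForm.e] at h0 ⊢
    linarith
  -- the per-edge bound `|W e| ≤ 3√B`
  have hW : ∀ e : Literature.MathematicalPhysics.QuantumLattice.ZdEdge 4, |W e| ≤ 3 * Real.sqrt B := by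
    rintro ⟨y, m⟩
    simp only [hWdef]
    by_cases hE : (y, m) ∈ boxEdges 4 (2 * H + 1)
    · -- cold-box edge (free or forest): everything cancels
      have hφE : φ y m = dν (y, m) - (if (m = 0 ∧ ∀ k : Fin 4, 1 ≤ y k ∧ y k + 1 ≤ 2 * (H : ℤ)) then ϑ (y, m) else 0) := by
        simp only [hφdef, if_pos hE]
      by_cases hfo : (m = 0 ∧ ∀ k : Fin 4, 1 ≤ y k ∧ y k + 1 ≤ 2 * (H : ℤ))
      · obtain ⟨rfl, hy⟩ := hfo
        have hG : G (y, 0) = ϑ (y, 0) := by rw [hGdef]; exact dirGlue0_of_forest ϑ hy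
        rw [hφE, if_pos ⟨rfl, hy⟩, hG]
        have : ϑ (y, 0) + (dν (y, 0) - ϑ (y, 0)) - dν (y, 0) = 0 := by ring
        rw [this, abs_zero]; positivity
      · have hf : (y, m) ∈ dirFreeEdges H := mem_dirFreeEdges.2 ⟨hE, hfo⟩
        have hG : G (y, m) = 0 := by rw [hGdef]; exact dirGlue0_of_mem_dirFreeEdges ϑ hf
        rw [hφE, if_neg hfo, hG]
        have : (0 : ℝ) + (dν (y, m) - 0) - dν (y, m) = 0 := by ring
        rw [this, abs_zero]; positivity
    · have hφ0 : φ y m = 0 := by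
        by_contra h; exact hE (hφ y m h)
      rw [hφ0, add_zero]
      by_cases hb : (y, m) ∈ boxEdgesAt dirCorner (2 * H + 3)
      · -- a pinned edge of the enlarged box off the cold box: shell or normal
        have hG : G (y, m) = ϑ (y, m) := by rw [hGdef]; exact dirGlue0_of_not_mem_coldBox ϑ hb hE
        rw [hG]
        have hyb := mem_dirBlock_iff.1 hb
        have hcm : ∀ k, (y + Pi.single m (1 : ℤ) : Site 4) k = if k = m then y m + 1 else y k := fun k => by
          simp only [Pi.add_apply, Pi.single_apply]; split_ifs with h <;> simp [h]
        by_cases hy : ∀ k, 0 ≤ y k ∧ y k ≤ 2 * (H : ℤ)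
        · by_cases hy' : ∀ k, 0 ≤ (y + Pi.single m (1 : ℤ) : Site 4) k ∧ (y + Pi.single m (1 : ℤ) : Site 4) k ≤ 2 * (H : ℤ)
          · -- both endpoints in the cold box: a cold-box edge after all
            exact absurd (mem_coldBoxEdges_iff.2 ⟨hy, by have := hy' m; rw [hcm, if_pos rfl] at this; omega⟩) hE
          · -- OUTWARD normal: `y ∈ Λ`, `y_m = 2H`
            have hym : y m = 2 * (H : ℤ) := by
              by_contra hne
              apply hy'
              intro k
              rw [hcm]
              split_ifs with hk
              · have := hy m; omega
              · exact hy k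
            have hex : ∃ j : Fin 4, y j = 2 * (H : ℤ) := ⟨m, hym⟩
            have hνy : ν y = -σ y := hνb y hy ⟨m, Or.inr hym⟩
            have hνy' : ν (y + Pi.single m (1 : ℤ)) = 0 := hν0 _ hy'
            have hd : dν (y, m) = σ y := by simp only [hdνdef, hνy, hνy']; ring
            rw [hd, hσtop y hex]
            by_cases hjm : hex.choose = m
            · rw [hjm, sub_self, abs_zero]; positivity
            · exact abs_theta_top_sub_top_le hB hy (Ne.symm hjm) hym hex.choose_spec
        · by_cases hy' : ∀ k, 0 ≤ (y + Pi.single m (1 : ℤ) : Site 4) k ∧ (y + Pi.single m (1 : ℤ) : Site 4) k ≤ 2 * (H : ℤ)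
          · -- INWARD normal: `v = y + e_m ∈ Λ`, `y_m = −1`
            set v : Site 4 := y + Pi.single m (1 : ℤ) with hv
            have hym : y m = -1 := by
              by_contra hne
              apply hy
              intro k
              by_cases hk : k = m
              · subst hk; have h1 := hy' k; rw [hcm, if_pos rfl] at h1; have := hyb.1 k; omega
              · have h1 := hy' k; rw [hcm, if_neg hk] at h1; exact h1
            have hvm : v m = 0 := by rw [hcm, if_pos rfl]; omega
            have hyv : y = v - Pi.single m (1 : ℤ) := by rw [hv, add_sub_cancel_right]
            have hνv : ν v = -σ v := hνb v hy' ⟨m, Or.inl hvm⟩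
            have hνy : ν y = 0 := hν0 _ hy
            have hd : dν (y, m) = -σ v := by simp only [hdνdef]; rw [← hv, hνv, hνy]; ring
            rw [hd]
            by_cases htop : ∃ j : Fin 4, v j = 2 * (H : ℤ)
            · rw [hσtop v htop]
              have hjm : htop.choose ≠ m := by
                intro h; have := htop.choose_spec; rw [h, hvm] at this; omega
              have h := abs_theta_top_add_bot_le hB hy' hjm htop.choose_spec hvm
              rw [← hyv] at h
              rwa [sub_neg_eq_add, add_comm]
            · have hbot : ∃ j : Fin 4, v j = 0 := ⟨m, hvm⟩
              rw [hσbot v htop hbot]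
              by_cases hkm : hbot.choose = m
              · have : ϑ (y, m) - -(-ϑ (v - Pi.single hbot.choose (1 : ℤ), hbot.choose)) = 0 := by
                  rw [hkm, ← hyv]; ring
                rw [this, abs_zero]; positivity
              · have h := abs_theta_bot_sub_bot_le hB hy' (Ne.symm hkm) hvm hbot.choose_spec
                rw [← hyv] at h
                have : ϑ (y, m) - -(-ϑ (v - Pi.single hbot.choose (1 : ℤ), hbot.choose)) =
                    ϑ (y, m) - ϑ (v - Pi.single hbot.choose (1 : ℤ), hbot.choose) := by ring
                rwa [this]
          · -- SHELL edge: both endpoints outside the cold box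
            have hνy : ν y = 0 := hν0 _ hy
            have hνy' : ν (y + Pi.single m (1 : ℤ)) = 0 := hν0 _ hy'
            have hd : dν (y, m) = 0 := by simp only [hdνdef, hνy, hνy', sub_self]
            rw [hd, sub_zero]
            -- a coordinate `k ≠ m` of `y` is extreme
            have hk : ∃ k, k ≠ m ∧ (y k = 2 * (H : ℤ) + 1 ∨ y k = -1) := by
              by_contra hcon
              push Not at hcon
              have hothers : ∀ k, k ≠ m → 0 ≤ y k ∧ y k ≤ 2 * (H : ℤ) := fun k hk => by
                have h1 := hcon k hk; have h2 := hyb.1 k; omega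
              -- then the bad coordinate of `y` is `m` itself, with `y m = −1`
              have hym : y m = -1 := by
                by_contra hne
                apply hy
                intro k
                by_cases hkm : k = m
                · subst hkm; have := hyb.1 k; have := hyb.2; omega
                · exact hothers k hkm
              apply hy'
              intro k
              rw [hcm]
              split_ifs with hkm
              · omega
              · exact hothers k hkm
            obtain ⟨k, hkm, hk⟩ := hk
            exact (abs_theta_shell_le hB hkm hb hk).trans (by linarith)
      · -- off the enlarged box: no endpoint in the cold box
        have hG : G (y, m) = 0 := by rw [hGdef]; exact dirGlue0_of_not_mem_dirBlock ϑ hb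
        have hνy : ν y = 0 := by
          refine hν0 _ fun hy => hb (mem_dirBlock_iff.2 ⟨fun k => by have := hy k; omega, by have := hy m; omega⟩)
        have hνy' : ν (y + Pi.single m (1 : ℤ)) = 0 := by
          refine hν0 _ fun hy => hb (mem_dirBlock_iff.2 ⟨fun k => ?_, ?_⟩)
          · have h1 := hy k
            simp only [Pi.add_apply, Pi.single_apply] at h1
            split_ifs at h1 <;> omega
          · have h1 := hy m
            simp only [Pi.add_apply, Pi.single_eq_same] at h1
            omega
        have hd : dν (y, m) = 0 := by simp only [hdνdef, hνy, hνy', sub_self]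
        rw [hG, hd, sub_zero, abs_zero]; positivity
  -- conclusion
  rw [hc]
  simp only [sCirc]
  have h1 := hW (p.1, p.2.1)
  have h2 := hW (p.1 + Pi.single p.2.1 1, p.2.2)
  have h3 := hW (p.1 + Pi.single p.2.2 1, p.2.1)
  have h4 := hW (p.1, p.2.2)
  -- four-term triangle inequality
  have t1 := abs_sub (W (p.1, p.2.1) + W (p.1 + Pi.single p.2.1 1, p.2.2) - W (p.1 + Pi.single p.2.2 1, p.2.1)) (W (p.1, p.2.2))
  have t2 := abs_sub (W (p.1, p.2.1) + W (p.1 + Pi.single p.2.1 1, p.2.2)) (W (p.1 + Pi.single p.2.2 1, p.2.1))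
  have t3 := abs_add_le (W (p.1, p.2.1)) (W (p.1 + Pi.single p.2.1 1, p.2.2))
  linarith

end Summit.QuantumFields.YangMills.Theorems.AllWindowsColdBoxBulkMidLine

end
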